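import Mathlib

/-!
# Crux `BinomialElusive.PeelingLemma` (stmt-ValiantsHypothesis-7391) — the ELIMINATION BASELINE

`PeelingLemma` asks: for all large `m`, every quadratic `Γ : ℂ^{m-1} → ℂ^m` and every formal
Laurent solution `p` of `Γ(p) = (t^{N a_i} + t^{N b_i})_i` force a nonzero integer relation
`Σ (u_i a_i + v_i b_i) = 0` of length `Σ(|u_i| + |v_i|) ≤ ⌊log₂ m⌋²`.

This file proves the same conclusion with the length bound `⌊log₂ m⌋²` replaced by the explicit
(exponential) bound `2m(2m+1)^{m-1}`, for EVERY `m ≥ 1`, every `Γ` of total degree `≤ 2`, every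
`N > 0` and every Laurent `p` — and with the relation supported on the LOWER exponents
`min(a_i, b_i)` only (`peelingLemma_eliminationBaseline`, `lowerExponents_relation`).  It is
the first result on the crux that uses the map `Γ` (the valuative / honest-case results in the
tree, `BinomialCandidateStubs.integralPeeling_valuative`, do not), and it records the trivial end
of the ladder of length bounds `f(m)` on which the crux sits at `f(m) = ⌊log₂ m⌋²`.

Mechanism (folklore elimination, Perron-type counting with a crude box bound):
* `exists_boxRelation`: `m` polynomials of total degree `≤ d` in `s < m` variables satisfy a
  nontrivial linear relation among the box power products `Π Γ_i^{α_i}`, `0 ≤ α_i ≤ L`,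
  `L = (dm+1)^{m-1}` — the `(L+1)^m` products live in the space of polynomials of total degree
  `≤ dmL`, whose box of monomials has `(dmL+1)^s < (L+1)^m` elements (linear algebra:
  `LinearMap.ker_ne_bot_of_finrank_lt`).
* `exists_orderRelation_of_sum_eq_zero`: if `Σ_α g_α Π T_i^{α_i} = 0` in `ℂ((t))` with `g ≠ 0`
  and all `T_i ≠ 0`, the minimum of the orders `Σ α_i ord T_i` over `supp g` is attained twice
  (otherwise the lowest coefficient of the sum is `g_α · lc ≠ 0`), giving a nonzero
  `w = α - α'` with `Σ w_i ord T_i = 0` and `Σ |w_i| ≤ 2mL`.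
* `orders_relation_of_aeval`: hence for ANY formal solution `Γ(p) = T` with all `T_i ≠ 0` the
  orders `ord T_i` are integrally related with length `≤ 2m(dm+1)^{m-1}`; for binomial targets
  `ord T_i = N · min(a_i, b_i)`.

What is NOT here: any use of the second exponents `b_i` (the content of the crux), any bound
polynomial or polylogarithmic in `m`.
-/

-- layout Summits/ValiantsHypothesis/ValiantsHypothesis forces the duplicated namespace component
set_option linter.dupNamespace false

namespace Summit.ValiantsHypothesis.ValiantsHypothesis.Theorems.PeelingLemmaBaseline

open scoped BigOperators
open Finset

/-! ## 1. Algebraic dependence with an explicit box -/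

/-- Counting: `(d(k+1)L + 1)^s < (L+1)^{k+1}` for `L = (d(k+1)+1)^k` and `s ≤ k`. -/
theorem box_count {d k s : ℕ} (hs : s ≤ k) :
    (d * (k + 1) * (d * (k + 1) + 1) ^ k + 1) ^ s < ((d * (k + 1) + 1) ^ k + 1) ^ (k + 1) := by
  set L := (d * (k + 1) + 1) ^ k with hL
  have h1 : d * (k + 1) * L + 1 ≤ (d * (k + 1) + 1) * (L + 1) := by nlinarith
  have h2 : 1 ≤ (d * (k + 1) + 1) * (L + 1) := Nat.one_le_iff_ne_zero.mpr (by positivity)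
  calc (d * (k + 1) * L + 1) ^ s ≤ ((d * (k + 1) + 1) * (L + 1)) ^ s := Nat.pow_le_pow_left h1 s
    _ ≤ ((d * (k + 1) + 1) * (L + 1)) ^ k := Nat.pow_le_pow_right h2 hs
    _ = L * (L + 1) ^ k := by rw [mul_pow, hL]
    _ < (L + 1) * (L + 1) ^ k := by
        apply Nat.mul_lt_mul_of_lt_of_le (Nat.lt_succ_self L) le_rfl
        positivity
    _ = (L + 1) ^ (k + 1) := by ring

/-- A polynomial of total degree `≤ n` all of whose coefficients at monomials of the box
`{e : ∀ j, e j ≤ n}` vanish is zero. -/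
theorem eq_zero_of_box_coeff {s n : ℕ} (Q : MvPolynomial (Fin s) ℂ) (hQ : Q.totalDegree ≤ n)
    (hbox : ∀ e : Fin s → Fin (n + 1),
      MvPolynomial.coeff (Finsupp.equivFunOnFinite.symm fun j => (e j : ℕ)) Q = 0) :
    Q = 0 := by
  classical
  ext x
  rw [MvPolynomial.coeff_zero]
  by_contra hx
  have hxs : x ∈ Q.support := MvPolynomial.mem_support_iff.mpr hx
  have hdeg : (x.sum fun _ e => e) ≤ n := (MvPolynomial.le_totalDegree hxs).trans hQ
  have hxj : ∀ j, x j ≤ n := fun j => by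
    have : x j ≤ x.sum fun _ e => e := by
      by_cases hj : j ∈ x.support
      · exact Finset.single_le_sum (f := fun i => x i) (fun _ _ => Nat.zero_le _) hj
      · rw [Finsupp.notMem_support_iff.mp hj]; exact Nat.zero_le _
    exact this.trans hdeg
  have := hbox fun j => ⟨x j, Nat.lt_succ_of_le (hxj j)⟩
  have hx' : (Finsupp.equivFunOnFinite.symm fun j => ((⟨x j, Nat.lt_succ_of_le (hxj j)⟩ :
      Fin (n + 1)) : ℕ)) = x := by
    ext j; simp
  rw [hx'] at this
  exact hx this

/-- **Box dependence.**  `m = k+1` polynomials `Γ_i` of total degree `≤ d` in `s ≤ k` variables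
over `ℂ` satisfy a nontrivial linear relation `Σ_α g_α Π_i Γ_i^{α_i} = 0` over the box
`α : Fin (k+1) → Fin (L+1)`, `L = (d(k+1)+1)^k`.  (Folklore counting / weak Perron bound.) -/
theorem exists_boxRelation {d k s : ℕ} (hs : s ≤ k) (Γ : Fin (k + 1) → MvPolynomial (Fin s) ℂ)
    (hΓ : ∀ i, (Γ i).totalDegree ≤ d) :
    ∃ g : (Fin (k + 1) → Fin ((d * (k + 1) + 1) ^ k + 1)) → ℂ, g ≠ 0 ∧
      ∑ α, g α • ∏ i, Γ i ^ ((α i : ℕ)) = 0 := by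
  classical
  set L := (d * (k + 1) + 1) ^ k with hL
  set n := d * (k + 1) * L with hn
  -- the power products and their degree
  set P : (Fin (k + 1) → Fin (L + 1)) → MvPolynomial (Fin s) ℂ := fun α => ∏ i, Γ i ^ ((α i : ℕ))
    with hP
  have hPdeg : ∀ α, (P α).totalDegree ≤ n := by
    intro α
    calc (P α).totalDegree ≤ ∑ i, (Γ i ^ ((α i : ℕ))).totalDegree :=
          MvPolynomial.totalDegree_finsetProd _ _
      _ ≤ ∑ i : Fin (k + 1), d * L := by
          refine sum_le_sum fun i _ => (MvPolynomial.totalDegree_pow _ _).trans ?_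
          have : (α i : ℕ) ≤ L := Nat.lt_succ_iff.mp (α i).isLt
          calc (α i : ℕ) * (Γ i).totalDegree ≤ L * d := Nat.mul_le_mul this (hΓ i)
            _ = d * L := by ring
      _ = n := by simp [hn]; ring
  have hQdeg : ∀ g : (Fin (k + 1) → Fin (L + 1)) → ℂ, (∑ α, g α • P α).totalDegree ≤ n := by
    intro g
    refine (MvPolynomial.totalDegree_finsetSum _ _).trans (Finset.sup_le fun α _ => ?_)
    exact (MvPolynomial.totalDegree_smul_le _ _).trans (hPdeg α)
  -- the coefficient-extraction map on the box
  let Φ : ((Fin (k + 1) → Fin (L + 1)) → ℂ) →ₗ[ℂ] ((Fin s → Fin (n + 1)) → ℂ) :=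
    { toFun := fun g e =>
        MvPolynomial.coeff (Finsupp.equivFunOnFinite.symm fun j => (e j : ℕ)) (∑ α, g α • P α)
      map_add' := fun g g' => by
        ext e
        simp only [Pi.add_apply, add_smul, sum_add_distrib, MvPolynomial.coeff_add]
      map_smul' := fun c g => by
        ext e
        simp only [Pi.smul_apply, smul_eq_mul, RingHom.id_apply, mul_smul, ← Finset.smul_sum,
          MvPolynomial.coeff_smul] }
  have hΦ : ∀ g e, Φ g e =
      MvPolynomial.coeff (Finsupp.equivFunOnFinite.symm fun j => (e j : ℕ)) (∑ α, g α • P α) :=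
    fun g e => rfl
  -- dimension count
  have hlt : Module.finrank ℂ ((Fin s → Fin (n + 1)) → ℂ) <
      Module.finrank ℂ ((Fin (k + 1) → Fin (L + 1)) → ℂ) := by
    rw [Module.finrank_fintype_fun_eq_card, Module.finrank_fintype_fun_eq_card,
      Fintype.card_fun, Fintype.card_fun, Fintype.card_fin, Fintype.card_fin, Fintype.card_fin,
      Fintype.card_fin]
    have := box_count (d := d) hs
    simpa [hn, hL] using this
  have hker := LinearMap.ker_ne_bot_of_finrank_lt (f := Φ) hlt
  obtain ⟨g, hgker, hg0⟩ := (Submodule.ne_bot_iff _).mp hker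
  refine ⟨g, hg0, ?_⟩
  apply eq_zero_of_box_coeff _ (hQdeg g)
  intro e
  have := congrArg (fun f => f e) (LinearMap.mem_ker.mp hgker)
  simpa [hΦ] using this

/-! ## 2. Lowest-order collision -/

/-- Orders of box power products of nonzero Laurent series. -/
theorem order_prod_pow {m : ℕ} (T : Fin m → LaurentSeries ℂ) (hT : ∀ i, T i ≠ 0) (α : Fin m → ℕ) :
    (∏ i, T i ^ α i) ≠ 0 ∧ (∏ i, T i ^ α i).order = ∑ i, (α i : ℤ) * (T i).order := by
  classical
  refine ⟨prod_ne_zero_iff.mpr fun i _ => pow_ne_zero _ (hT i), ?_⟩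
  induction (univ : Finset (Fin m)) using Finset.induction_on with
  | empty => simp
  | insert i S hi ih =>
    rw [prod_insert hi, sum_insert hi, HahnSeries.order_mul (pow_ne_zero _ (hT i))
      (prod_ne_zero_iff.mpr fun j _ => pow_ne_zero _ (hT j)), ih, HahnSeries.order_pow]
    simp

/-- **Lowest-order collision.**  If `Σ_α g_α Π_i T_i^{α_i} = 0` in `ℂ((t))` with `g ≠ 0`, all
`T_i ≠ 0` and `α` ranging over a box `Fin m → Fin (L+1)`, then two distinct box points in the
support of `g` have the same order `Σ α_i ord T_i`; their difference is a nonzero `w : Fin m → ℤ`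
with `Σ |w_i| ≤ 2mL` and `Σ w_i ord T_i = 0`. -/
theorem exists_orderRelation_of_sum_eq_zero {m L : ℕ} (T : Fin m → LaurentSeries ℂ)
    (hT : ∀ i, T i ≠ 0) (g : (Fin m → Fin (L + 1)) → ℂ) (hg : g ≠ 0)
    (hsum : ∑ α, g α • ∏ i, T i ^ ((α i : ℕ)) = 0) :
    ∃ w : Fin m → ℤ, w ≠ 0 ∧ ∑ i, |w i| ≤ ((2 * m * L : ℕ) : ℤ) ∧ ∑ i, w i * (T i).order = 0 := by
  classical
  set X : (Fin m → Fin (L + 1)) → LaurentSeries ℂ := fun α => ∏ i, T i ^ ((α i : ℕ)) with hX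
  set O : (Fin m → Fin (L + 1)) → ℤ := fun α => ∑ i, ((α i : ℕ) : ℤ) * (T i).order with hOdef
  have hX0 : ∀ α, X α ≠ 0 := fun α => (order_prod_pow T hT fun i => (α i : ℕ)).1
  have hXord : ∀ α, (X α).order = O α := fun α => (order_prod_pow T hT fun i => (α i : ℕ)).2
  set S : Finset (Fin m → Fin (L + 1)) := univ.filter fun α => g α ≠ 0 with hS
  have hSne : S.Nonempty := by
    obtain ⟨α, hα⟩ := Function.ne_iff.mp hg
    exact ⟨α, mem_filter.mpr ⟨mem_univ _, hα⟩⟩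
  obtain ⟨α₀, hα₀S, hmin⟩ := exists_min_image S O hSne
  have hg₀ : g α₀ ≠ 0 := (mem_filter.mp hα₀S).2
  by_cases hcoll : ∃ α₁ ∈ S, α₁ ≠ α₀ ∧ O α₁ = O α₀
  · obtain ⟨α₁, -, hne, hOeq⟩ := hcoll
    refine ⟨fun i => ((α₀ i : ℕ) : ℤ) - ((α₁ i : ℕ) : ℤ), ?_, ?_, ?_⟩
    · intro h
      apply hne
      funext i
      have := congrFun h i
      simp only [Pi.zero_apply, sub_eq_zero, Nat.cast_inj] at this
      exact Fin.ext this.symm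
    · calc ∑ i, |((α₀ i : ℕ) : ℤ) - ((α₁ i : ℕ) : ℤ)| ≤ ∑ i : Fin m, (2 * L : ℤ) := by
            refine sum_le_sum fun i _ => ?_
            have h0 : ((α₀ i : ℕ) : ℤ) ≤ L := by exact_mod_cast Nat.lt_succ_iff.mp (α₀ i).isLt
            have h1 : ((α₁ i : ℕ) : ℤ) ≤ L := by exact_mod_cast Nat.lt_succ_iff.mp (α₁ i).isLt
            have h0' : (0 : ℤ) ≤ ((α₀ i : ℕ) : ℤ) := by positivity
            have h1' : (0 : ℤ) ≤ ((α₁ i : ℕ) : ℤ) := by positivity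
            rw [abs_le]; constructor <;> linarith
        _ = ((2 * m * L : ℕ) : ℤ) := by simp; ring
    · have : ∑ i, (((α₀ i : ℕ) : ℤ) - ((α₁ i : ℕ) : ℤ)) * (T i).order = O α₀ - O α₁ := by
        simp only [hOdef, sub_mul, sum_sub_distrib]
      rw [this, hOeq, sub_self]
  · -- unique minimum: the lowest coefficient of the sum is `g α₀ · lc (X α₀) ≠ 0`
    exfalso
    push Not at hcoll
    have hlt : ∀ α, g α ≠ 0 → α ≠ α₀ → O α₀ < O α := by
      intro α hα hne
      have hαS : α ∈ S := mem_filter.mpr ⟨mem_univ _, hα⟩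
      exact lt_of_le_of_ne (hmin α hαS) (fun h => hcoll α hαS hne h.symm)
    have hcoeff : (∑ α, g α • X α).coeff (O α₀) = g α₀ * (X α₀).coeff (O α₀) := by
      rw [HahnSeries.coeff_sum, sum_eq_single α₀]
      · rw [HahnSeries.coeff_smul, smul_eq_mul]
      · intro α _ hne
        rw [HahnSeries.coeff_smul, smul_eq_mul]
        by_cases hα : g α = 0
        · rw [hα, zero_mul]
        · rw [HahnSeries.coeff_eq_zero_of_lt_order (by rw [hXord]; exact hlt α hα hne), mul_zero]
      · intro h; exact absurd (mem_univ α₀) h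
    have hlc : (X α₀).coeff (O α₀) ≠ 0 := by
      rw [← hXord]; exact fun h => hX0 α₀ (HahnSeries.coeff_order_eq_zero.mp h)
    have := congrArg (fun x : LaurentSeries ℂ => x.coeff (O α₀)) hsum
    simp only [HahnSeries.coeff_zero] at this
    rw [hcoeff] at this
    exact (mul_ne_zero hg₀ hlc) this

/-! ## 3. Orders of formally swallowed curves are related -/

/-- **Orders are related.**  If `m = k+1` polynomials `Γ_i` of total degree `≤ d` in `s ≤ k`
variables take, at a point `p ∈ ℂ((t))^s`, nonzero values `T_i = Γ_i(p)`, then the orders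
`ord T_i` satisfy a nonzero integer relation of length `≤ 2(k+1)(d(k+1)+1)^k`. -/
theorem orders_relation_of_aeval {d k s : ℕ} (hs : s ≤ k) (Γ : Fin (k + 1) → MvPolynomial (Fin s) ℂ)
    (hΓ : ∀ i, (Γ i).totalDegree ≤ d) (p : Fin s → LaurentSeries ℂ)
    (hT : ∀ i, MvPolynomial.aeval p (Γ i) ≠ 0) :
    ∃ w : Fin (k + 1) → ℤ, w ≠ 0 ∧
      ∑ i, |w i| ≤ ((2 * (k + 1) * (d * (k + 1) + 1) ^ k : ℕ) : ℤ) ∧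
      ∑ i, w i * (MvPolynomial.aeval p (Γ i)).order = 0 := by
  obtain ⟨g, hg0, hrel⟩ := exists_boxRelation hs Γ hΓ
  have hsum : ∑ α, g α • ∏ i, (MvPolynomial.aeval p (Γ i)) ^ ((α i : ℕ)) = 0 := by
    have := congrArg (MvPolynomial.aeval p) hrel
    rw [map_sum, map_zero] at this
    rw [← this]
    refine sum_congr rfl fun α _ => ?_
    -- `ℂ`-scalars enter `LaurentSeries ℂ` through `HahnSeries.C` (the `Algebra ℂ (LaurentSeries ℂ)`
    -- instance factors through power series; unfold it by `rfl` to avoid the `SMul` diamond)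
    rw [MvPolynomial.smul_eq_C_mul, map_mul, MvPolynomial.aeval_C, map_prod,
      show algebraMap ℂ (LaurentSeries ℂ) (g α) =
        HahnSeries.ofPowerSeries ℤ ℂ (PowerSeries.C (g α)) from rfl,
      HahnSeries.ofPowerSeries_C, HahnSeries.C_mul_eq_smul]
    simp only [map_pow]
  exact exists_orderRelation_of_sum_eq_zero _ hT g hg0 hsum

/-! ## 4. Binomial targets: the baseline for `PeelingLemma` -/

/-- A binomial target `t^{A} + t^{B}` (coefficients `1`, possibly `A = B`) is nonzero and has
order `min A B`. -/
theorem binomial_ne_zero_and_order (A B : ℤ) :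
    (HahnSeries.single A (1 : ℂ) + HahnSeries.single B (1 : ℂ) : LaurentSeries ℂ) ≠ 0 ∧
    (HahnSeries.single A (1 : ℂ) + HahnSeries.single B (1 : ℂ) : LaurentSeries ℂ).order = min A B := by
  -- reduce to `A ≤ B`
  wlog hAB : A ≤ B generalizing A B
  · have := this B A (le_of_not_ge hAB)
    rw [add_comm, min_comm] at this
    exact this
  rw [min_eq_left hAB]
  rcases eq_or_lt_of_le hAB with rfl | hlt
  · rw [← HahnSeries.single_add, show (1 : ℂ) + 1 = 2 by norm_num]
    exact ⟨by simp, HahnSeries.order_single (by norm_num)⟩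
  · have hcoeff : (HahnSeries.single A (1 : ℂ) + HahnSeries.single B (1 : ℂ) :
        LaurentSeries ℂ).coeff A = 1 := by
      rw [HahnSeries.coeff_add, HahnSeries.coeff_single_same, HahnSeries.coeff_single_of_ne hlt.ne]
      simp
    have hne : (HahnSeries.single A (1 : ℂ) + HahnSeries.single B (1 : ℂ) : LaurentSeries ℂ) ≠ 0 := by
      intro h; rw [h] at hcoeff; simp at hcoeff
    refine ⟨hne, le_antisymm (HahnSeries.order_le_of_coeff_ne_zero (by rw [hcoeff]; exact one_ne_zero)) ?_⟩
    have := HahnSeries.min_order_le_order_add (Γ := ℤ) (R := ℂ)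
      (x := HahnSeries.single A (1 : ℂ)) (y := HahnSeries.single B (1 : ℂ)) hne
    rwa [HahnSeries.order_single one_ne_zero, HahnSeries.order_single one_ne_zero,
      min_eq_left hAB] at this

/-- **Lower-exponent relation.**  For `m = k+1`, every `Γ` of total degree `≤ d` in `s ≤ k`
variables and every Laurent solution of `Γ_i(p) = t^{N a_i} + t^{N b_i}`: the lower exponents
`min(a_i, b_i)` satisfy a nonzero integer relation of length `≤ 2(k+1)(d(k+1)+1)^k`. -/
theorem lowerExponents_relation {d k s : ℕ} (hs : s ≤ k) (a b : Fin (k + 1) → ℕ)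
    (Γ : Fin (k + 1) → MvPolynomial (Fin s) ℂ) (hΓ : ∀ i, (Γ i).totalDegree ≤ d) {N : ℕ}
    (hN : 0 < N) (p : Fin s → LaurentSeries ℂ)
    (hp : ∀ i, MvPolynomial.aeval p (Γ i) =
      HahnSeries.single ((N * a i : ℕ) : ℤ) (1 : ℂ) + HahnSeries.single ((N * b i : ℕ) : ℤ) (1 : ℂ)) :
    ∃ w : Fin (k + 1) → ℤ, w ≠ 0 ∧
      ∑ i, |w i| ≤ ((2 * (k + 1) * (d * (k + 1) + 1) ^ k : ℕ) : ℤ) ∧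
      ∑ i, w i * (min (a i) (b i) : ℤ) = 0 := by
  have hT : ∀ i, MvPolynomial.aeval p (Γ i) ≠ 0 := fun i => by
    rw [hp i]; exact (binomial_ne_zero_and_order _ _).1
  have hord : ∀ i, (MvPolynomial.aeval p (Γ i)).order = (N : ℤ) * (min (a i) (b i) : ℤ) := by
    intro i
    rw [hp i, (binomial_ne_zero_and_order _ _).2]
    push_cast
    rw [← mul_min_of_nonneg _ _ (by positivity : (0 : ℤ) ≤ N)]
  obtain ⟨w, hw0, hlen, hrel⟩ := orders_relation_of_aeval hs Γ hΓ p hT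
  refine ⟨w, hw0, hlen, ?_⟩
  simp only [hord] at hrel
  have : (N : ℤ) * ∑ i, w i * (min (a i) (b i) : ℤ) = 0 := by
    rw [mul_sum]
    rw [← hrel]
    exact sum_congr rfl fun i _ => by ring
  exact (mul_eq_zero.mp this).resolve_left (by exact_mod_cast hN.ne')

/-- **`PeelingLemma`, elimination baseline.**  The statement of the crux
`BinomialElusive.PeelingLemma` with its length bound `⌊log₂ m⌋²` replaced by
`2m(2m+1)^{m-1}`, for every `m ≥ 1` (so `m₀ = 1`): every quadratic `Γ : ℂ^{m-1} → ℂ^m` and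
every Laurent solution of `Γ(p) = (t^{N a_i} + t^{N b_i})_i` force a nonzero integer relation
`Σ(u_i a_i + v_i b_i) = 0` with `Σ(|u_i| + |v_i|) ≤ 2m(2m+1)^{m-1}` — indeed one supported on
the lower exponents (`u_i v_i = 0`, the coefficient sits on `min(a_i, b_i)`). -/
theorem peelingLemma_eliminationBaseline :
    ∀ m ≥ 1, ∀ (a b : Fin m → ℕ) (Γ : Fin m → MvPolynomial (Fin (m - 1)) ℂ) (N : ℕ)
      (p : Fin (m - 1) → LaurentSeries ℂ), (∀ i, (Γ i).totalDegree ≤ 2) → 0 < N →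
      (∀ i, MvPolynomial.aeval p (Γ i) =
        HahnSeries.single ((N * a i : ℕ) : ℤ) (1 : ℂ) + HahnSeries.single ((N * b i : ℕ) : ℤ) (1 : ℂ)) →
      ∃ u v : Fin m → ℤ, (u, v) ≠ 0 ∧
        ∑ i, (|u i| + |v i|) ≤ ((2 * m * (2 * m + 1) ^ (m - 1) : ℕ) : ℤ) ∧
        ∑ i, (u i * (a i : ℤ) + v i * (b i : ℤ)) = 0 := by
  intro m hm a b Γ N p hΓ hN hp
  obtain ⟨k, rfl⟩ : ∃ k, m = k + 1 := ⟨m - 1, by omega⟩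
  obtain ⟨w, hw0, hlen, hrel⟩ :=
    lowerExponents_relation (d := 2) (k := k) (s := k + 1 - 1) (by omega) a b Γ hΓ hN p hp
  have hbound : ((2 * (k + 1) * (2 * (k + 1) + 1) ^ (k + 1 - 1) : ℕ) : ℤ) =
      ((2 * (k + 1) * (2 * (k + 1) + 1) ^ k : ℕ) : ℤ) := by
    simp
  refine ⟨fun i => if a i ≤ b i then w i else 0, fun i => if a i ≤ b i then 0 else w i, ?_, ?_, ?_⟩
  · intro h
    apply hw0
    funext i
    have hu := congrFun (congrArg Prod.fst h) i
    have hv := congrFun (congrArg Prod.snd h) i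
    by_cases hi : a i ≤ b i
    · simpa [hi] using hu
    · simpa [hi] using hv
  · calc ∑ i, (|(if a i ≤ b i then w i else 0)| + |(if a i ≤ b i then 0 else w i)|)
        = ∑ i, |w i| := sum_congr rfl fun i _ => by split_ifs <;> simp
      _ ≤ _ := hlen
      _ = _ := hbound.symm
  · calc ∑ i, ((if a i ≤ b i then w i else 0) * (a i : ℤ) + (if a i ≤ b i then 0 else w i) * (b i : ℤ))
        = ∑ i, w i * (min (a i) (b i) : ℤ) := by
          refine sum_congr rfl fun i _ => ?_
          by_cases hi : a i ≤ b i
          · simp [hi]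
          · simp [hi, (not_le.mp hi).le]
      _ = 0 := hrel

end Summit.ValiantsHypothesis.ValiantsHypothesis.Theorems.PeelingLemmaBaseline
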